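import Summits.CriticalPhenomena.PercolationContinuityZ3.Theorems.PercNearOneGluingNoHeavyLowerTailSahiOneStepThresholdTwoPrelim
import HarnessLib

/-!
# One-step scheme, THRESHOLD-TWO instance, part 2/2: THEOREM Th₂ — Kahn's Conjecture 5 / Sahi's `C₃` for the first slot
# `H_F = {at least two coordinates of F present}`, the other two slots ARBITRARY increasing events, every product measure

Support file (prover prim-ineq-prove-3 gen 15; `--supports stmt-CriticalPhenomena-4575`; memo
`run/shared/lean/prim/prim-ineq-prove-3/FINDING-G14-ONESTEP-THRESHOLD.md` §4 + gen-15 addendum `FINDING-G15-TH2-KERNEL.md`).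
No definitions, no named facts, no sorries, no `native_decide`.

With `H = H_F := {ω | ∃ i ∈ F, ∃ j ∈ F, i ≠ j ∧ i ∈ ω ∧ j ∈ ω}` (increasing, determined by `F`) the one-step scheme
`SahiOneStep.sahiE3_nonneg_of_ind` (`…SahiOneStepCone`) reduces `E₃(H, A, B) ≥ 0` for ALL increasing `A, B` to two inequalities for
up-sets `A, B` DETERMINED BY `F`:
* §4 `osMp_ind_ind_thresholdTwo_nonneg` — (3′) `(1 + μH)μ(HAB) ≥ μ(H)μ(AB) + μ(HA)μ(HB)` (a quantitative Harris inequality,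
  `Cov(1_{HA},1_{HB}) ≥ μ(H)·μ(AB ∖ H)`);
* §5 `osN_ind_ind_thresholdTwo_nonneg` — (2′) `μ(HA)μ(HB) + μ(Hᶜ)μ(HAB) + μ(H)μ(A)μ(B) ≥ μ(HA)μ(B) + μ(HB)μ(A)`
  (`Cov(A,B) ≥ μ(Hᶜ)·Cov(A,B ∣ Hᶜ)`).
Both are proved DIRECTLY by the block decomposition of part 1 along the common-generator set `I = {i ∈ F | {i} ∈ A ∩ B}`
(`C = C_I ⊆ A ∩ B`, `A ∩ B ∖ H = C ∖ H`, outer sections `X^ = {ω ∖ I ∈ X}` independent of the block): after substituting the block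
identities each target is an explicit sum of products of nonnegative quantities — Harris for two outer sections, Harris for the
increasing `C` against the decreasing `Hᶜ`, monotonicity, and `μ(C ∩ H^) ≤ μ(C ∩ H)`.  No two-copy argument and no Kleitman-type
counting is needed (this supersedes the fibre route of the memo's §4.2).
* §6 **`sahiE3_thresholdTwo_nonneg`**: `0 ≤ E₃(H_F, A, B)` for all increasing `A, B ⊆ 2^ι`, every `p : ι → [0,1]`, every `F`;
  `sahiE3_two_le_card_nonneg`: the same slot written `{ω | 2 ≤ #{i ∈ F | i ∈ ω}}`.
  (`|F| = 2`: cylinder; `3`: majority `maj₃`; `4`: covered by `…SahiTransportJRFour`; `|F| ≥ 5`: new.)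
-/

noncomputable section

namespace Summit.CriticalPhenomena.PercolationContinuityZ3.Theorems

namespace SahiOneStep

open MeasureTheory
open Literature.Probability.Percolation (DeterminedBy determinedBy_iff)
open Literature.Probability.LatticeModels (prodBernoulli sahiE3 prodBernoulli_real_inter_of_determinedBy prodBernoulli_harris
  prodBernoulli_harris_upper_lower)
open Literature.Probability.Percolation.DecisionTree (ind)
open SahiCdd (orEvent)
open scoped Classical

variable {ι : Type*} [Fintype ι]

/-! ## §3′ The block identity for a general first slot `H ⊇ H_F` -/

omit [Fintype ι] in
/-- For an increasing `H ⊇ H_F` and `A, B, I` as in the common-generator lemma: `A ∩ B ∖ H = C_I ∖ H`. [this work] -/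
theorem inter_diff_eq_orEvent_diff {F : Finset ι} {H A B : Set (Set ι)}
    (hH2 : {ω : Set ι | ∃ i ∈ F, ∃ j ∈ F, i ≠ j ∧ i ∈ ω ∧ j ∈ ω} ⊆ H) (hA : IsUpperSet A) (hB : IsUpperSet B)
    (hAF : DeterminedBy A (F : Set ι)) (hBF : DeterminedBy B (F : Set ι)) (hne : (∅ : Set ι) ∉ A ∩ B) {I : Finset ι}
    (hI : ∀ i, i ∈ I ↔ i ∈ F ∧ ({i} : Set ι) ∈ A ∩ B) :
    (A ∩ B) \ H = (orEvent I : Set (Set ι)) \ H := by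
  apply Set.Subset.antisymm
  · intro ω hω
    exact ⟨inter_diff_thresholdTwo_subset_orEvent hAF hBF hne hI ⟨hω.1, fun h => hω.2 (hH2 h)⟩, hω.2⟩
  · exact Set.sdiff_subset_sdiff_left (orEvent_subset_inter hA hB fun i hi => ((hI i).1 hi).2)

/-- Measure form: `μ(A ∩ B) − μ(H ∩ A ∩ B) = μ(C_I) − μ(C_I ∩ H)`. [this work] -/
theorem real_inter_sub_eq_of_subset {F : Finset ι} (p : ι → unitInterval) {H A B : Set (Set ι)}
    (hH2 : {ω : Set ι | ∃ i ∈ F, ∃ j ∈ F, i ≠ j ∧ i ∈ ω ∧ j ∈ ω} ⊆ H) (hA : IsUpperSet A) (hB : IsUpperSet B)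
    (hAF : DeterminedBy A (F : Set ι)) (hBF : DeterminedBy B (F : Set ι)) (hne : (∅ : Set ι) ∉ A ∩ B) {I : Finset ι}
    (hI : ∀ i, i ∈ I ↔ i ∈ F ∧ ({i} : Set ι) ∈ A ∩ B) :
    (prodBernoulli p).real (A ∩ B) - (prodBernoulli p).real (H ∩ A ∩ B) =
      (prodBernoulli p).real (orEvent I : Set (Set ι)) - (prodBernoulli p).real ((orEvent I : Set (Set ι)) ∩ H) := by
  have h1 := real_diff_eq p (A ∩ B) H
  have h2 := real_diff_eq p (orEvent I : Set (Set ι)) H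
  rw [inter_diff_eq_orEvent_diff hH2 hA hB hAF hBF hne hI] at h1
  have h3 : H ∩ A ∩ B = A ∩ B ∩ H := by
    ext ω; simp only [Set.mem_inter_iff]; tauto
  rw [h3]
  linarith

/-! ## §4 Hypothesis (3′) for `H_F`: `m′(1_A,1_B) ≥ 0` — a quantitative Harris inequality -/

/-- **(3) for the threshold-two slot.**  For all increasing `A, B` determined by `F`, with `H = H_F`:
`(1 + μ H)·μ(H ∩ A ∩ B) − μ(H)·μ(A ∩ B) − μ(H ∩ A)·μ(H ∩ B) ≥ 0`, i.e. `Cov(1_{H∩A}, 1_{H∩B}) ≥ μ(H)·μ(A ∩ B ∖ H)`.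
Proof (block decomposition along the common-generator set `I`, `C = C_I`, `Z = Z_I`, `θ = μ(C)`, `h = μ(C ∩ H)`, `x_X = μ(H^ ∩ X^)`):
the target equals `μ(Z)·[(x_{AB} − x_A x_B) + δ·((1 − x_A)(1 − x_B) + (x_H − x_A x_B)) + θ·(x_H − x_A)(x_H − x_B)]` EXACTLY, where
`x_{AB} ≥ x_A x_B` is Harris for the outer sections and `δ = h − θ·x_H = μ(C ∩ H) − μ(C ∩ H^) ≥ 0`. [this work] -/
theorem osMp_ind_ind_nonneg_of_thresholdTwo_subset (p : ι → unitInterval) (F : Finset ι) {H A B : Set (Set ι)}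
    (hH : IsUpperSet H) (hH2 : {ω : Set ι | ∃ i ∈ F, ∃ j ∈ F, i ≠ j ∧ i ∈ ω ∧ j ∈ ω} ⊆ H)
    (hA : IsUpperSet A) (hB : IsUpperSet B) (hAF : DeterminedBy A (F : Set ι)) (hBF : DeterminedBy B (F : Set ι)) :
    0 ≤ osMp p H (ind A) (ind B) := by
  rw [osMp_ind_ind]
  set μ := prodBernoulli p with hμ
  by_cases hne : (∅ : Set ι) ∈ A ∩ B
  · have hAu : A = Set.univ := Set.eq_univ_of_forall fun ω => hA (Set.empty_subset ω) hne.1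
    have hBu : B = Set.univ := Set.eq_univ_of_forall fun ω => hB (Set.empty_subset ω) hne.2
    subst hAu; subst hBu
    simp only [Set.inter_univ, probReal_univ]
    exact le_of_eq (by ring)
  · set I : Finset ι := F.filter (fun i => ({i} : Set ι) ∈ A ∩ B) with hIdef
    have hI : ∀ i, i ∈ I ↔ i ∈ F ∧ ({i} : Set ι) ∈ A ∩ B := fun i => by rw [hIdef, Finset.mem_filter]
    have hCI : (orEvent I : Set (Set ι)) ⊆ A ∩ B := orEvent_subset_inter hA hB fun i hi => ((hI i).1 hi).2
    set C : Set (Set ι) := orEvent I with hC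
    set Hh : Set (Set ι) := {ω : Set ι | ω \ (I : Set ι) ∈ H} with hHh
    set Ah : Set (Set ι) := {ω : Set ι | ω \ (I : Set ι) ∈ A} with hAh
    set Bh : Set (Set ι) := {ω : Set ι | ω \ (I : Set ι) ∈ B} with hBh
    -- block identities
    have e4 : μ.real H = μ.real (C ∩ H) + μ.real Cᶜ * μ.real Hh := by
      rw [real_eq_orEvent_inter_add p I H, real_compl_orEvent_inter p I H]
    have e2 : μ.real (H ∩ A) = μ.real (C ∩ H) + μ.real Cᶜ * μ.real (Hh ∩ Ah) := by
      rw [real_eq_orEvent_inter_add p I (H ∩ A), real_compl_orEvent_inter p I (H ∩ A), sdiff_mem_inter]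
      have hs : C ∩ (H ∩ A) = C ∩ H := by
        ext ω; simp only [Set.mem_inter_iff]
        exact ⟨fun h => ⟨h.1, h.2.1⟩, fun h => ⟨h.1, h.2, (hCI h.1).1⟩⟩
      rw [hs]
    have e3 : μ.real (H ∩ B) = μ.real (C ∩ H) + μ.real Cᶜ * μ.real (Hh ∩ Bh) := by
      rw [real_eq_orEvent_inter_add p I (H ∩ B), real_compl_orEvent_inter p I (H ∩ B), sdiff_mem_inter]
      have hs : C ∩ (H ∩ B) = C ∩ H := by
        ext ω; simp only [Set.mem_inter_iff]
        exact ⟨fun h => ⟨h.1, h.2.1⟩, fun h => ⟨h.1, h.2, (hCI h.1).2⟩⟩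
      rw [hs]
    have e1 : μ.real (H ∩ A ∩ B) = μ.real (C ∩ H) + μ.real Cᶜ * μ.real (Hh ∩ Ah ∩ Bh) := by
      rw [real_eq_orEvent_inter_add p I (H ∩ A ∩ B), real_compl_orEvent_inter p I (H ∩ A ∩ B), sdiff_mem_inter,
        sdiff_mem_inter]
      have hs : C ∩ (H ∩ A ∩ B) = C ∩ H := by
        ext ω; simp only [Set.mem_inter_iff]
        exact ⟨fun h => ⟨h.1, h.2.1.1⟩, fun h => ⟨h.1, ⟨h.2, (hCI h.1).1⟩, (hCI h.1).2⟩⟩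
      rw [hs]
    have e5 : μ.real (A ∩ B) = μ.real (H ∩ A ∩ B) + μ.real C - μ.real (C ∩ H) := by
      have h := real_inter_sub_eq_of_subset p hH2 hA hB hAF hBF hne hI
      linarith
    have e6 : μ.real Cᶜ = 1 - μ.real C := by
      have h := real_orEvent_add_compl p I
      linarith
    -- inequalities
    have hHh_up : IsUpperSet Hh := isUpperSet_sdiff_mem hH _
    have hAh_up : IsUpperSet Ah := isUpperSet_sdiff_mem hA _
    have hBh_up : IsUpperSet Bh := isUpperSet_sdiff_mem hB _
    have harris : μ.real (Hh ∩ Ah) * μ.real (Hh ∩ Bh) ≤ μ.real (Hh ∩ Ah ∩ Bh) := by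
      have h := prodBernoulli_harris p (hHh_up.inter hAh_up) (hHh_up.inter hBh_up) MeasurableSet.of_discrete
        MeasurableSet.of_discrete
      have hset : Hh ∩ Ah ∩ (Hh ∩ Bh) = Hh ∩ Ah ∩ Bh := by
        ext ω; simp only [Set.mem_inter_iff]; tauto
      rw [hset] at h
      exact h
    have key : μ.real C * μ.real Hh ≤ μ.real (C ∩ H) := by
      rw [← real_orEvent_inter_sdiff_mem p I H]
      exact measureReal_mono (Set.inter_subset_inter_right _ (sdiff_mem_subset hH _))
    have mA : μ.real (Hh ∩ Ah) ≤ μ.real Hh := measureReal_mono Set.inter_subset_left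
    have mB : μ.real (Hh ∩ Bh) ≤ μ.real Hh := measureReal_mono Set.inter_subset_left
    have mH : μ.real Hh ≤ 1 := measureReal_le_one
    have n0A : 0 ≤ μ.real (Hh ∩ Ah) := measureReal_nonneg
    have n0B : 0 ≤ μ.real (Hh ∩ Bh) := measureReal_nonneg
    have nθ : 0 ≤ μ.real C := measureReal_nonneg
    have nQ : 0 ≤ 1 - μ.real C := by rw [← e6]; exact measureReal_nonneg
    have hAB1 : μ.real (Hh ∩ Ah) * μ.real (Hh ∩ Bh) ≤ μ.real Hh := by nlinarith
    -- the certificate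
    have t1 : 0 ≤ (1 - μ.real C) * (μ.real (Hh ∩ Ah ∩ Bh) - μ.real (Hh ∩ Ah) * μ.real (Hh ∩ Bh)) :=
      mul_nonneg nQ (by linarith)
    have t2 : 0 ≤ (1 - μ.real C) * ((μ.real (C ∩ H) - μ.real C * μ.real Hh) *
        ((1 - μ.real (Hh ∩ Ah)) * (1 - μ.real (Hh ∩ Bh)) + (μ.real Hh - μ.real (Hh ∩ Ah) * μ.real (Hh ∩ Bh)))) :=
      mul_nonneg nQ (mul_nonneg (by linarith) (add_nonneg (mul_nonneg (by linarith) (by linarith)) (by linarith)))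
    have t3 : 0 ≤ (1 - μ.real C) * (μ.real C * ((μ.real Hh - μ.real (Hh ∩ Ah)) * (μ.real Hh - μ.real (Hh ∩ Bh)))) :=
      mul_nonneg nQ (mul_nonneg nθ (mul_nonneg (by linarith) (by linarith)))
    rw [e5, e1, e2, e3, e4, e6]
    linarith [t1, t2, t3]

/-! ## §5 Hypothesis (2′) for `H_F`: `n(1_A,1_B) ≥ 0`, i.e. `Cov(A,B) ≥ μ(Hᶜ)·Cov(A,B ∣ Hᶜ)` -/

/-- **(2) for the threshold-two slot.**  For all increasing `A, B` determined by `F`, with `H = H_F`, `L = Hᶜ`: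
`μ(HA)μ(HB) + μ(L)μ(HAB) + μ(H)μ(A)μ(B) − μ(HA)μ(B) − μ(HB)μ(A) ≥ 0`.
Proof: with `C = C_I`, `θ = μ(C)`, `s = μ(A ∩ B ∩ L) = θ − μ(C ∩ H)`, `a_L = μ(A ∩ L)`, `b_L = μ(B ∩ L)`, `l = μ(L)`,
`λ = μ(L ∖ (A ∪ B))` and the outer sections `a = μ(A^)`, `b = μ(B^)`, `m = μ(A^ ∩ B^)`, the target equals EXACTLY
`l(1−θ)²(m − ab) + lθ·μ(H ∖ (A ∪ B)) + (a_L − s)(b_L − s) + λ(lθ − s)`; `m ≥ ab` is Harris for the outer sections and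
`s = μ(C ∩ L) ≤ μ(C)μ(L) = θl` is Harris for the increasing `C` and the decreasing `L`. [this work] -/
theorem osN_ind_ind_nonneg_of_thresholdTwo_subset (p : ι → unitInterval) (F : Finset ι) {H A B : Set (Set ι)}
    (hH : IsUpperSet H) (hH2 : {ω : Set ι | ∃ i ∈ F, ∃ j ∈ F, i ≠ j ∧ i ∈ ω ∧ j ∈ ω} ⊆ H)
    (hA : IsUpperSet A) (hB : IsUpperSet B) (hAF : DeterminedBy A (F : Set ι)) (hBF : DeterminedBy B (F : Set ι)) :
    0 ≤ osN p H (ind A) (ind B) := by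
  rw [osN_ind_ind]
  set μ := prodBernoulli p with hμ
  by_cases hne : (∅ : Set ι) ∈ A ∩ B
  · have hAu : A = Set.univ := Set.eq_univ_of_forall fun ω => hA (Set.empty_subset ω) hne.1
    have hBu : B = Set.univ := Set.eq_univ_of_forall fun ω => hB (Set.empty_subset ω) hne.2
    subst hAu; subst hBu
    simp only [Set.inter_univ, probReal_univ]
    exact le_of_eq (by ring)
  · set I : Finset ι := F.filter (fun i => ({i} : Set ι) ∈ A ∩ B) with hIdef
    have hI : ∀ i, i ∈ I ↔ i ∈ F ∧ ({i} : Set ι) ∈ A ∩ B := fun i => by rw [hIdef, Finset.mem_filter]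
    have hCI : (orEvent I : Set (Set ι)) ⊆ A ∩ B := orEvent_subset_inter hA hB fun i hi => ((hI i).1 hi).2
    set C : Set (Set ι) := orEvent I with hC
    set Ah : Set (Set ι) := {ω : Set ι | ω \ (I : Set ι) ∈ A} with hAh
    set Bh : Set (Set ι) := {ω : Set ι | ω \ (I : Set ι) ∈ B} with hBh
    -- block identities
    have r1 : μ.real A = μ.real C + μ.real Cᶜ * μ.real Ah := by
      rw [real_eq_orEvent_inter_add p I A, real_compl_orEvent_inter p I A,
        Set.inter_eq_left.2 (hCI.trans Set.inter_subset_left)]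
    have r2 : μ.real B = μ.real C + μ.real Cᶜ * μ.real Bh := by
      rw [real_eq_orEvent_inter_add p I B, real_compl_orEvent_inter p I B,
        Set.inter_eq_left.2 (hCI.trans Set.inter_subset_right)]
    have r3 : μ.real (A ∩ B) = μ.real C + μ.real Cᶜ * μ.real (Ah ∩ Bh) := by
      rw [real_eq_orEvent_inter_add p I (A ∩ B), real_compl_orEvent_inter p I (A ∩ B), sdiff_mem_inter,
        Set.inter_eq_left.2 hCI]
    have e5 : μ.real (A ∩ B) - μ.real (H ∩ A ∩ B) = μ.real C - μ.real (C ∩ H) :=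
      real_inter_sub_eq_of_subset p hH2 hA hB hAF hBF hne hI
    have e6 : μ.real Cᶜ = 1 - μ.real C := by
      have h := real_orEvent_add_compl p I
      linarith
    have hl : μ.real Hᶜ = 1 - μ.real H := probReal_compl_eq_one_sub MeasurableSet.of_discrete
    -- inequalities
    have hAh_up : IsUpperSet Ah := isUpperSet_sdiff_mem hA _
    have hBh_up : IsUpperSet Bh := isUpperSet_sdiff_mem hB _
    have harris : μ.real Ah * μ.real Bh ≤ μ.real (Ah ∩ Bh) :=
      prodBernoulli_harris p hAh_up hBh_up MeasurableSet.of_discrete MeasurableSet.of_discrete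
    have r6 : μ.real C - μ.real (C ∩ H) ≤ μ.real C * μ.real Hᶜ := by
      rw [← real_diff_eq p C H, Set.sdiff_eq]
      exact prodBernoulli_harris_upper_lower p (isUpperSet_orEvent I) hH.compl MeasurableSet.of_discrete
        MeasurableSet.of_discrete
    have r7 : μ.real (A ∩ B) - μ.real (H ∩ A ∩ B) ≤ μ.real A - μ.real (H ∩ A) := by
      rw [Set.inter_assoc, ← real_compl_inter p H (A ∩ B), ← real_compl_inter p H A]
      exact measureReal_mono (Set.inter_subset_inter_right _ Set.inter_subset_left)
    have r8 : μ.real (A ∩ B) - μ.real (H ∩ A ∩ B) ≤ μ.real B - μ.real (H ∩ B) := by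
      rw [Set.inter_assoc, ← real_compl_inter p H (A ∩ B), ← real_compl_inter p H B]
      exact measureReal_mono (Set.inter_subset_inter_right _ Set.inter_subset_right)
    have r9 : 0 ≤ μ.real Hᶜ - (μ.real A - μ.real (H ∩ A)) - (μ.real B - μ.real (H ∩ B)) +
        (μ.real (A ∩ B) - μ.real (H ∩ A ∩ B)) := by
      have h := real_inter_add_inter_le p Hᶜ A B
      rw [real_compl_inter p H A, real_compl_inter p H B, Set.inter_assoc, real_compl_inter p H (A ∩ B),
        ← Set.inter_assoc] at h
      linarith
    have r10 : 0 ≤ μ.real H - μ.real (H ∩ A) - μ.real (H ∩ B) + μ.real (H ∩ A ∩ B) := by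
      have h := real_inter_add_inter_le p H A B
      linarith
    have nθ : 0 ≤ μ.real C := measureReal_nonneg
    have nl : 0 ≤ 1 - μ.real H := by rw [← hl]; exact measureReal_nonneg
    -- the certificate
    have t1 : 0 ≤ (1 - μ.real H) * ((1 - μ.real C) * (1 - μ.real C)) * (μ.real (Ah ∩ Bh) - μ.real Ah * μ.real Bh) :=
      mul_nonneg (mul_nonneg nl (mul_self_nonneg _)) (by linarith)
    have t2 : 0 ≤ (1 - μ.real H) * μ.real C * (μ.real H - μ.real (H ∩ A) - μ.real (H ∩ B) + μ.real (H ∩ A ∩ B)) :=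
      mul_nonneg (mul_nonneg nl nθ) r10
    have t3 : 0 ≤ ((μ.real A - μ.real (H ∩ A)) - (μ.real (A ∩ B) - μ.real (H ∩ A ∩ B))) *
        ((μ.real B - μ.real (H ∩ B)) - (μ.real (A ∩ B) - μ.real (H ∩ A ∩ B))) :=
      mul_nonneg (by linarith) (by linarith)
    have t4 : 0 ≤ (μ.real Hᶜ - (μ.real A - μ.real (H ∩ A)) - (μ.real B - μ.real (H ∩ B)) +
        (μ.real (A ∩ B) - μ.real (H ∩ A ∩ B))) * (μ.real C * μ.real Hᶜ - (μ.real C - μ.real (C ∩ H))) :=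
      mul_nonneg r9 (by linarith)
    rw [hl] at t4
    have e7 : μ.real (H ∩ A ∩ B) = μ.real (A ∩ B) - μ.real C + μ.real (C ∩ H) := by linarith
    rw [e7, r3, e6] at t2
    rw [e7, r1, r2, r3, e6] at t3
    rw [e7, r1, r2, r3, e6] at t4
    rw [e7, r1, r2, r3, e6]
    linarith [t1, t2, t3, t4]

/-! ## §6 THEOREMS: every increasing slot `H ⊇ H_F` determined by `F`; Th₂; "OR of `J`, or two of `F`" -/

/-- **THEOREM (block criterion).**  Let `H` be increasing, determined by `F`, and contain `H_F = {at least two coordinates of F present}`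
(equivalently: `H = univ`, or `H = C_J ∪ H_F` for some `J ⊆ F`).  Then Kahn's Conjecture 5 / Sahi's `C₃` holds for the slot `H`:
`0 ≤ E₃(H, A, B)` for ALL increasing `A, B ⊆ 2^ι`, every `p : ι → [0,1]`.  One-step scheme `sahiE3_nonneg_of_ind` + §4–§5. [this work] -/
theorem sahiE3_nonneg_of_thresholdTwo_subset (p : ι → unitInterval) (F : Finset ι) {H : Set (Set ι)} (hH : IsUpperSet H)
    (hHF : DeterminedBy H (F : Set ι)) (hH2 : {ω : Set ι | ∃ i ∈ F, ∃ j ∈ F, i ≠ j ∧ i ∈ ω ∧ j ∈ ω} ⊆ H)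
    {A B : Set (Set ι)} (hA : IsUpperSet A) (hB : IsUpperSet B) :
    0 ≤ sahiE3 (prodBernoulli p) H A B :=
  sahiE3_nonneg_of_ind p hHF
    (fun _ _ hA' hB' hAF hBF => osMp_ind_ind_nonneg_of_thresholdTwo_subset p F hH hH2 hA' hB' hAF hBF)
    (fun _ _ hA' hB' hAF hBF => osN_ind_ind_nonneg_of_thresholdTwo_subset p F hH hH2 hA' hB' hAF hBF) hA hB

/-- **THEOREM Th₂ (Kahn's Conjecture 5 / Sahi's `C₃` for the slot "at least two coordinates of `F` are present").**
For every finite `ι`, every `p : ι → [0,1]`, every finset `F ⊆ ι` and ALL increasing `A, B ⊆ 2^ι`: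
`0 ≤ E₃({ω | ∃ i ≠ j ∈ F, i, j ∈ ω}, A, B)` under the product measure `prodBernoulli p`.
(`|F| ≤ 1`: the slot is empty; `|F| = 2`: a cylinder; `|F| = 3`: majority; `|F| = 4`: inside `…SahiTransportJRFour`; `|F| ≥ 5` new.)
[this work] -/
theorem sahiE3_thresholdTwo_nonneg (p : ι → unitInterval) (F : Finset ι) {A B : Set (Set ι)}
    (hA : IsUpperSet A) (hB : IsUpperSet B) :
    0 ≤ sahiE3 (prodBernoulli p) {ω : Set ι | ∃ i ∈ F, ∃ j ∈ F, i ≠ j ∧ i ∈ ω ∧ j ∈ ω} A B :=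
  sahiE3_nonneg_of_thresholdTwo_subset p F (isUpperSet_thresholdTwo F) (determinedBy_thresholdTwo F) subset_rfl hA hB

/-- The same with the slot written by cardinality: `{ω | 2 ≤ #{i ∈ F | i ∈ ω}}`. [this work] -/
theorem sahiE3_two_le_card_nonneg (p : ι → unitInterval) (F : Finset ι) {A B : Set (Set ι)}
    (hA : IsUpperSet A) (hB : IsUpperSet B) :
    0 ≤ sahiE3 (prodBernoulli p) {ω : Set ι | 2 ≤ (F.filter (fun i => i ∈ ω)).card} A B := by
  have hset : {ω : Set ι | 2 ≤ (F.filter (fun i => i ∈ ω)).card} =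
      {ω : Set ι | ∃ i ∈ F, ∃ j ∈ F, i ≠ j ∧ i ∈ ω ∧ j ∈ ω} := by
    ext ω
    simp only [Set.mem_setOf_eq]
    change 1 < (F.filter (fun i => i ∈ ω)).card ↔ _
    rw [Finset.one_lt_card]
    constructor
    · rintro ⟨i, hi, j, hj, hij⟩
      rw [Finset.mem_filter] at hi hj
      exact ⟨i, hi.1, j, hj.1, hij, hi.2, hj.2⟩
    · rintro ⟨i, hi, j, hj, hij, hiω, hjω⟩
      exact ⟨i, Finset.mem_filter.2 ⟨hi, hiω⟩, j, Finset.mem_filter.2 ⟨hj, hjω⟩, hij⟩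
  rw [hset]
  exact sahiE3_thresholdTwo_nonneg p F hA hB

omit [Fintype ι] in
/-- `H_{J ∪ F} ⊆ C_J ∪ H_F`: two present coordinates of `J ∪ F` contain one of `J` or two of `F`. [this work] -/
theorem thresholdTwo_union_subset (J F : Finset ι) :
    {ω : Set ι | ∃ i ∈ J ∪ F, ∃ j ∈ J ∪ F, i ≠ j ∧ i ∈ ω ∧ j ∈ ω} ⊆
      (orEvent J : Set (Set ι)) ∪ {ω : Set ι | ∃ i ∈ F, ∃ j ∈ F, i ≠ j ∧ i ∈ ω ∧ j ∈ ω} := by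
  rintro ω ⟨i, hi, j, hj, hij, hiω, hjω⟩
  rw [Finset.mem_union] at hi hj
  rcases hi with hi | hi
  · exact Or.inl ⟨i, hi, hiω⟩
  rcases hj with hj | hj
  · exact Or.inl ⟨j, hj, hjω⟩
  · exact Or.inr ⟨i, hi, j, hj, hij, hiω, hjω⟩

/-- **THEOREM ("OR of `J`, or at least two of `F`").**  For all finsets `J, F` and the slot `H = C_J ∪ H_F =
{ω | ω ∩ J ≠ ∅ ∨ #(ω ∩ F) ≥ 2}`: `0 ≤ E₃(H, A, B)` for all increasing `A, B`, every product measure.  `F = ∅` is the OR / hitting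
slot (`…SahiHittingSlot`, `…SahiCdd`), `J = ∅` is Th₂, `J = {a}, F = {b,c}` is the junta `a ∨ bc`, `J = {a}, F = {b,c,d}` is
`a ∨ maj(b,c,d)`; the general member interpolates between the OR slot and the threshold-two slot. [this work] -/
theorem sahiE3_orEvent_union_thresholdTwo_nonneg (p : ι → unitInterval) (J F : Finset ι) {A B : Set (Set ι)}
    (hA : IsUpperSet A) (hB : IsUpperSet B) :
    0 ≤ sahiE3 (prodBernoulli p) ((orEvent J : Set (Set ι)) ∪ {ω : Set ι | ∃ i ∈ F, ∃ j ∈ F, i ≠ j ∧ i ∈ ω ∧ j ∈ ω}) A B := by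
  refine sahiE3_nonneg_of_thresholdTwo_subset p (J ∪ F) ((isUpperSet_orEvent J).union (isUpperSet_thresholdTwo F)) ?_
    (thresholdTwo_union_subset J F) hA hB
  have h1 : DeterminedBy (orEvent J : Set (Set ι)) (↑(J ∪ F) : Set ι) :=
    (determinedBy_orEvent J).mono (by rw [Finset.coe_union]; exact Set.subset_union_left)
  have h2 : DeterminedBy {ω : Set ι | ∃ i ∈ F, ∃ j ∈ F, i ≠ j ∧ i ∈ ω ∧ j ∈ ω} (↑(J ∪ F) : Set ι) :=
    (determinedBy_thresholdTwo F).mono (by rw [Finset.coe_union]; exact Set.subset_union_right)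
  rw [determinedBy_iff] at h1 h2 ⊢
  intro ω ω' h
  rw [Set.mem_union, Set.mem_union, h1 ω ω' h, h2 ω ω' h]

end SahiOneStep

end Summit.CriticalPhenomena.PercolationContinuityZ3.Theorems
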